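import Summits.ABC.ABC.Theses.IUTThetaPilot
import Summits.ABC.ABC.Theorems.IUTThetaPilotJInvWlog
import Summits.ABC.ABC.Theorems.IUTThetaPilotThetaPartIIOfThm110
import Summits.ABC.ABC.Theorems.IUTThetaPilotGenEllTwo
import HarnessLib

set_option linter.dupNamespace false

/-!
# Route `route-ABC-IUTThetaPilot`: with `GenEllTwo` and `JInvWlog` PROVED, the summit `ABC` hinges on the
# crux `ThetaPartII` alone — equivalently on the ONE named interface `Cor22.Thm110Legendre`

S. Mochizuki, *Inter-universal Teichmüller theory IV*, Cor. 2.2–2.3 pp. 41–55, and *Arithmetic elliptic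
curves in general position*, Thm. 2.1 [cite: Mochizuki2012, IUTchIV Cor. 2.3 p.54]
[cite: MochizukiGenEll2010, Thm 2.1 pp.11–13].  The route's deciding theorem is
`closes : ThetaPartII → GenEllTwo → JInvWlog → ABC`; its two SUPPORT inputs are now theorems of the tree
(`genEllTwo_holds`, this cell's [GenEll] Thm 2.1 (ii) ⇒ (i) at `Σ = {2}`; `JInvWlog_proof`), so the summit
statement `ABC` follows from the crux `ThetaPartII` ([IUTchIV] Cor. 2.2 (ii), OPEN — it rests on
[IUTchIII] Cor. 3.12, DISPUTED), equivalently (abc-iut-S3's `ThetaPartII_of_thm110Legendre`) from the single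
named interface `Cor22.Thm110Legendre`.  CONDITIONAL RESULTS (the gate records `proof.conditional`); the crux
item stays open.  HONEST FRAMING: nothing here asserts abc; no side is taken on [IUTchIII] Cor. 3.12; these two
theorems only make kernel-visible that the IUT route to `ABC`, as typed in this tree, now has exactly ONE open
input.
-/

namespace Summit.ABC.ABC.Theorems

/-- **`ABC` from the crux alone**: `ThetaPartII → ABC` — the route's `closes` with both support inputs
discharged by theorems of the tree (`genEllTwo_holds`, `JInvWlog_proof`). Conditional; asserts nothing
about the crux. [cite: Mochizuki2012, IUTchIV Cor. 2.3 p.54] -/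
theorem ABC_of_thetaPartII (hII : Summit.ABC.ABC.Theses.IUTThetaPilot.ThetaPartII) : _root_.ABC :=
  Summit.ABC.ABC.Theses.IUTThetaPilot.closes hII genEllTwo_holds JInvWlog_proof

/-- **`ABC` from the ONE named interface of the disputed chain**: `Cor22.Thm110Legendre → ABC`
(what [IUTchIV] Cor. 2.2 (ii) takes from Theorem 1.10, which rests on [IUTchIII] Cor. 3.12 — DISPUTED, never
asserted here), by `ABC_of_thm110Legendre_of_genEllTwo` with `GenEllTwo` now proved.
[cite: Mochizuki2012, IUTchIV Cor. 2.2–2.3 pp.41–55] -/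
theorem ABC_of_thm110Legendre (hH : Literature.IUT.LogVolume.Cor22.Thm110Legendre) : _root_.ABC :=
  ABC_of_thm110Legendre_of_genEllTwo hH genEllTwo_holds

end Summit.ABC.ABC.Theorems
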